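import Summits.QuantumFields.BalabanUV.Beta.SymmetrisedDressingLinear
import Summits.QuantumFields.BalabanUV.Beta.FP.BiVertexLimit
import Summits.QuantumFields.BalabanUV.Beta.KernelWardSwap

/-!
# `BalabanUV.Beta.FP.BiVertexDressSym` — road «FP» for binder row D1, `RESIDUAL-FP.md` §9 ROW #14 literal side «COPROJ₂-SYM» (owner item, journal
# 2026-08-21T08:42Z; first refusal leaf-06): THE BLOCK-MEAN DRESSING OF THE BI-VERTEX THROUGH THE CO-DRESSED LEG IS THE BI-VERTEX THROUGH THE UNDRESSED LEG
# OF A TWICE-PROJECTED, DRESSED BI-TABLE — `Π̂ (vertex2OfK (Π̂ᵀKΠ̂) N S₂ μ y ν y′) Π̂ᵀ = vertex2OfK K N Ŝ₂ μ y ν y′`,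
# `Ŝ₂ κ u κ′ u′ := Π̂ (Π̂ᵀ_bond,2 (Π̂ᵀ_bond,1 S₂) κ u) κ′ u′ Π̂ᵀ` — the bi-vertex twin of an2's `SymmetrisedDressingLinear.vertexOfK_dressSymAt_S` applied twice

HONEST DEPENDENCY (page 1, mandatory): continuum YM on T⁴ ⇐ BetaPertH ∧ nine spine estimates (0/9 proved); BetaPertH ⇐ (D1) ∧ (D4) ∧ CAP+tail;
G-an2-4 gates asym, D1 and NE2/3/4.  HONEST FRAMING (cell contract, verbatim): «discharging `BetaPertH` makes Bałaban's UV stability UNCONDITIONAL —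
a real constructive-QFT result; it is NOT the continuum limit and NOT the Clay problem.»  THIS MODULE DISCHARGES NOTHING of the wall: it is [folklore]
finite-window ∕ absolutely-convergent-series bookkeeping composed BY NAME from an2's `SymmetrisedDressingLinear` (`vertexOfK_dressKSymAt`, `vertexOfK_coProjSymAtK`,
`colH_coDressKSymAt_eq`, `coProjSymAt_tsum`), an2's `decays_coDressKSymAt`, Literature `SecondOrderResponse.biLoc_vertexOfK_slice`,
`AxialDressing.summable_colH_mul_stencil`, the owner's `FP/BiVertexLimit.locStencil_slice_of_locStencil₂` and an1's `KernelWardSwap.vertex2OfK_swap_eq_transpose`.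
No `def` (the twice-projected dressed bi-table `Ŝ₂` is written as an explicit lambda; `_congr` forms accept any named object with that pointwise identity),
no `def … : Prop`, nothing cited, 0 sorry; every decay ∕ localisation letter is a HYPOTHESIS with free constants, asserted for no object of Bałaban's.
0∕4 row-D1 binders; NOT X1-S₂ rates, NOT (G8)∕(G-mix-W), NOT `hsplit` for the literal (FILE 2), NOT (ASYMP), NOT D1, NOT BetaPertH, NOT continuum, NOT Clay.
«not in print; our bookkeeping».

ABSOLUTE RULE (cell charter, verbatim): «No internally-minted statement may enter as a cited fact. Every hypothesis is either kernel-proved in this package or a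
verbatim quotation of a PUBLISHED theorem with page reference. The manuscript(s) under audit are NOT citable for their own disputed steps — they are the thing
under adjudication; programme-internal (2001/route/tribunal) claims are never citable.»

WHY (owner, `RESIDUAL-FP.md` §10 addendum v1.7.4).  In the LEFT placement of record the literal's second-order slot is `(JsB12Sym j).W = Π̂ ∘ W⁰_j ∘ Π̂ᵀ`
(`dressSymAt_W`, `rfl`) with `W⁰_j = W2SymOfK (Gsym j) Lc …` built on the CO-DRESSED resolvent `Gsym j = Π̂ᵀ K_j Π̂`, whereas the (ASYMP) socket's slot is
`vertex2OfK (KPerf m) …` through the UNDRESSED leg.  This file supplies the kernel identity that moves the dressing from the leg to the bi-table, at every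
finite `j`; FILE 2 draws the literal's `hsplit` from it (`BiVertexLimit.unitW_vertex2OfK` ∕ `limTabOf_split_of_rates`).

NOTATION (in-block root `ρ := toSite r`, `1 ≤ N`, `r ∈ box (d+1) N`): `D := dressKSymAt ρ N` (`Π̂ · Π̂ᵀ`), `P := coProjSymAtK ρ N` (the bond-slot window `Π̂ᵀ_bm` of a
stencil family), `G := coDressKSymAt ρ N K` (`Π̂ᵀ K Π̂`); for a bi-table `S₂ κ u κ′ u′`: the SLOT-1 projection at `(κ, u)` is the stencil family
`κ′ u′ ↦ P (β w ↦ S₂ β w κ′ u′) κ u`, and `Ŝ₂ κ u κ′ u′ := D (P (that family) κ′ u′)`.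

CONTENT.
* §1 [folklore] `coProjSymAt_finset_sum`, `coProjSymAt_mul_left'` (linearity of the window in finite sums ∕ scalars); **`vertexOfK_dressSym_of_locStencil`** —
  an2's `vertexOfK_dressSymAt_S` for a BARE local stencil family: `vertexOfK K N (κ u ↦ D (P S κ u)) μ y = D (vertexOfK G N S μ y)`; `abs_le_of_locStencil₂`;
  **`locStencil_innerVertex`** (`κ u ↦ vertexOfK G N (S₂ κ u) ν y′` is a local stencil family at rate `m`); **`coProjSymAtK_innerVertex`** (the window passes INTO
  the inner vertex's stencil slot: `P (κ u ↦ vertexOfK G N (S₂ κ u) ν y′) κ u = vertexOfK G N (slot-1 projection at (κ,u)) ν y′` — needs only summability of the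
  `ℋ`-column series, any root); **`locStencil_slotOneProj`** (the slot-1 projection at `(κ, u)` is a local stencil family in `(κ′, u′)` at rate `m∕2`, constant
  `card(cube)·(d+1)·(1+4(d+1)N)·C₂`).
* §2 [folklore] **`dressKSymAt_vertex2OfK_coDress`** — THE IDENTITY: `Decays K C δ` (`0 < δ`), `LocStencil₂ S₂ C₂ m` (`0 < m`), in-block root ⟹
  `D (vertex2OfK G N S₂ μ y ν y′) = vertex2OfK K N Ŝ₂ μ y ν y′` (the common rate for `G` and `S₂` is taken inside: an2's `decays_coDressKSymAt` +
  `decays_mono` ∕ `LocStencil₂.mono`); `…_congr` for a named `Ŝ₂`.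
* §3 [folklore] THE SYMMETRIC CASE: `abs_le_of_locStencil₂`; **`vertex2OfK_swap_of_symm`** — for a slot-symmetric bounded bi-table the swapped bi-vertex IS the
  direct one (an1's `KernelWardSwap.vertex2OfK_swap_eq_transpose`); **`half_sum_vertex2OfK_of_symm`** — the symmetrised bi-vertex `½•(V μyνy′ + V νy′μy)` IS `vertex2OfK`.
Provenance: D1 formalisation swarm LEAF PROVER 06, unit b2b-balaban-beta-d1-formalise-leaf-06 gen 11 (prover-b2b-balaban-beta-d1-formalise-leaf-06-g11-0),
2026-08-21; owner item «COPROJ₂-SYM» (journal l.29341), MINE l.29358, STATEMENT l.29384.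
-/

noncomputable section

namespace Summit.QuantumFields.BalabanUV.Beta.FP.BiVertexDressSym

open Finset
open scoped BigOperators
open Literature.MathematicalPhysics.QuantumFieldTheory
open Literature.MathematicalPhysics.QuantumFieldTheory.Balaban1983to89
open Literature.MathematicalPhysics.QuantumFieldTheory.Balaban1983to89.Beta
open B12Sec2to5 (l1 l1_nonneg)
open ExpKernelCalculus (MKer Decays BiLoc Zl Zl_nonneg)
open AffineAveraging (Form1 box toSite)
open OneStepResolventKernel (Fib wsum LocStencil decays_mono)
open OneStepKernelFamily (colH vertexOfK)
open BalabanCompositeJets (LocStencil₂)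
open SecondOrderResponse (vertex2OfK biLoc_vertexOfK_slice)
open Summit.QuantumFields.BalabanUV.Beta.AxialDressingRooted (cube)
open Summit.QuantumFields.BalabanUV.Beta.SymmetrisedDressingMatrix (pmSymBm)
open Summit.QuantumFields.BalabanUV.Beta.SymmetrisedDressingKernel (dressKSymAt coDressKSymAt decays_coDressKSymAt)
open Summit.QuantumFields.BalabanUV.Beta.SymmetrisedDressingLegs (coProjSymAt coProjSymAt_apply abs_pmSymBm_le')
open Summit.QuantumFields.BalabanUV.Beta.SymmetrisedDressingDress (coProjSymAtK coProjSymAtK_eval locStencil_coProjSymAtK)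
open Summit.QuantumFields.BalabanUV.Beta.SymmetrisedDressingLinear (coProjSymAt_tsum vertexOfK_dressKSymAt vertexOfK_coProjSymAtK
  colH_coDressKSymAt_eq)
open Summit.QuantumFields.BalabanUV.Beta.FP.BiVertexLimit (locStencil_slice_of_locStencil₂)
open Summit.QuantumFields.BalabanUV.Beta.KernelWardSwap (vertex2OfK_swap_eq_transpose)

variable {d : ℕ}

/-! ## §1 Linearity of the window; the vertex transfer for a bare stencil family; the inner vertices and their slot-1 projections -/

section Window

variable (ρ : Fin (d + 1) → ℤ) (N : ℕ)

/-- [folklore] The bond-slot window is additive over finite sums of one-forms (finite sums commute). -/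
theorem coProjSymAt_finset_sum {ι : Type*} (s : Finset ι) (g : ι → Form1 (d + 1) ℝ) (α : Fin (d + 1)) (q : Fin (d + 1) → ℤ) :
    coProjSymAt ρ N (fun κ p => ∑ i ∈ s, g i κ p) α q = ∑ i ∈ s, coProjSymAt ρ N (g i) α q := by
  simp only [coProjSymAt_apply, Finset.mul_sum]
  calc ∑ v ∈ cube (d + 1) N, ∑ β : Fin (d + 1), ∑ i ∈ s, pmSymBm ρ N β (q + v) α q * g i β (q + v)
      = ∑ v ∈ cube (d + 1) N, ∑ i ∈ s, ∑ β : Fin (d + 1), pmSymBm ρ N β (q + v) α q * g i β (q + v) :=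
        Finset.sum_congr rfl fun v _ => Finset.sum_comm
    _ = ∑ i ∈ s, ∑ v ∈ cube (d + 1) N, ∑ β : Fin (d + 1), pmSymBm ρ N β (q + v) α q * g i β (q + v) := Finset.sum_comm

/-- [folklore] The bond-slot window is homogeneous (scalars pass). -/
theorem coProjSymAt_mul_left' (c : ℝ) (g : Form1 (d + 1) ℝ) (α : Fin (d + 1)) (q : Fin (d + 1) → ℤ) :
    coProjSymAt ρ N (fun κ p => c * g κ p) α q = c * coProjSymAt ρ N g α q := by
  simp only [coProjSymAt_apply, Finset.mul_sum]
  exact Finset.sum_congr rfl fun v _ => Finset.sum_congr rfl fun β _ => by ring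

end Window

section Transfer

variable {N : ℕ} {r : Fin (d + 1) → ℕ}

/-- [folklore] **THE VERTEX TRANSFER FOR A BARE LOCAL STENCIL FAMILY** (an2's `SymmetrisedDressingLinear.vertexOfK_dressSymAt_S` without the `JetData`
packaging; his three lemmas composed, nothing restated): for a decaying `K`, a local stencil family `S` and an in-block root,
`vertexOfK K N (κ u ↦ Π̂ (Π̂ᵀ_bond S κ u) Π̂ᵀ) μ y = Π̂ (vertexOfK (Π̂ᵀ K Π̂) N S μ y) Π̂ᵀ`. -/
theorem vertexOfK_dressSym_of_locStencil (hN : 1 ≤ N) (hr : r ∈ box (d + 1) N) {K : MKer (d + 1) (Fib d)} {C δ : ℝ}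
    (hK : Decays K C δ) (hδ : 0 < δ) {S : Fin (d + 1) → (Fin (d + 1) → ℤ) → MKer (d + 1) (Fib d)} {Cs δs : ℝ}
    (hS : LocStencil S Cs δs) (hδs : 0 < δs) (μ : Fin (d + 1)) (y : Fin (d + 1) → ℤ) :
    vertexOfK K N (fun κ u => dressKSymAt (toSite r) N (coProjSymAtK (toSite r) N S κ u)) μ y =
      dressKSymAt (toSite r) N (vertexOfK (coDressKSymAt (toSite r) N K) N S μ y) := by
  have e1 : vertexOfK K N (fun κ u => dressKSymAt (toSite r) N (coProjSymAtK (toSite r) N S κ u)) μ y =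
      dressKSymAt (toSite r) N (vertexOfK K N (coProjSymAtK (toSite r) N S) μ y) :=
    vertexOfK_dressKSymAt (toSite r) N hK hδ.le (locStencil_coProjSymAtK hN hr hS hδs.le) hδs μ y
  rw [e1]
  congr 1
  funext x z a b
  rw [vertexOfK_coProjSymAtK hN hr hK hδ hS hδs.le, ← colH_coDressKSymAt_eq]
  rfl

/-- [folklore] A `LocStencil₂` bi-table has uniformly bounded entries (by its constant). -/
theorem abs_le_of_locStencil₂ {S₂ : Fin (d + 1) → (Fin (d + 1) → ℤ) → Fin (d + 1) → (Fin (d + 1) → ℤ) → MKer (d + 1) (Fib d)}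
    {C₂ m : ℝ} (hS₂ : LocStencil₂ S₂ C₂ m) (hm : 0 ≤ m) (κ : Fin (d + 1)) (u : Fin (d + 1) → ℤ) (κ' : Fin (d + 1))
    (u' x z : Fin (d + 1) → ℤ) (a b : Fib d) : |S₂ κ u κ' u' x z a b| ≤ C₂ := by
  have hC₂ := hS₂.nonneg
  have h := hS₂ κ u κ' u' x z a b
  refine h.trans ?_
  have e1 : Real.exp (-m * l1 (u' - u)) ≤ 1 := by
    rw [Real.exp_le_one_iff]; nlinarith [l1_nonneg (u' - u)]
  have e2 : Real.exp (-m * (l1 (x - u) + l1 (z - u))) ≤ 1 := by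
    rw [Real.exp_le_one_iff]; nlinarith [l1_nonneg (x - u), l1_nonneg (z - u)]
  calc C₂ * Real.exp (-m * l1 (u' - u)) * Real.exp (-m * (l1 (x - u) + l1 (z - u))) ≤ C₂ * 1 * 1 := by
        gcongr
    _ = C₂ := by ring

/-- [folklore] **THE INNER VERTICES OF A LOCAL BI-TABLE FORM A LOCAL STENCIL FAMILY**: for `G` decaying at rate `m` and `LocStencil₂ S₂ C₂ m`,
`κ u ↦ vertexOfK G N (S₂ κ u) ν y′` is `LocStencil` at rate `m` with constant `(d+1)·(C·C₂·Zl(m/2))` (Literature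
`SecondOrderResponse.biLoc_vertexOfK_slice`, the far-centre factor `e^{−(m/2)|u − N•y′|} ≤ 1` dropped). -/
theorem locStencil_innerVertex {G : MKer (d + 1) (Fib d)} {C m : ℝ} (hG : Decays G C m) (hC : 0 ≤ C)
    {S₂ : Fin (d + 1) → (Fin (d + 1) → ℤ) → Fin (d + 1) → (Fin (d + 1) → ℤ) → MKer (d + 1) (Fib d)} {C₂ : ℝ}
    (hS₂ : LocStencil₂ S₂ C₂ m) (hm : 0 < m) (ν : Fin (d + 1)) (y' : Fin (d + 1) → ℤ) :
    LocStencil (fun κ u => vertexOfK G N (S₂ κ u) ν y') ((d + 1 : ℕ) * (C * C₂ * Zl (d + 1) (m / 2))) m := by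
  intro κ u x z a b
  have h := biLoc_vertexOfK_slice (N := N) hG hC hS₂ hm κ u ν y' x z a b
  refine h.trans (mul_le_mul_of_nonneg_right ?_ (Real.exp_pos _).le)
  have hZ := Zl_nonneg (D := d + 1) (half_pos hm)
  have hC₂ := hS₂.nonneg
  have he : Real.exp (-(m / 2) * l1 (u - (N : ℤ) • y')) ≤ 1 := by
    rw [Real.exp_le_one_iff]; nlinarith [l1_nonneg (u - (N : ℤ) • y')]
  have hA : 0 ≤ C * C₂ * Zl (d + 1) (m / 2) := mul_nonneg (mul_nonneg hC hC₂) hZ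
  exact mul_le_mul_of_nonneg_left (mul_le_of_le_one_right hA he) (Nat.cast_nonneg _)

/-- [folklore] **THE BOND-SLOT WINDOW PASSES INTO THE INNER VERTEX's STENCIL SLOT** (any root; `G` decaying, `LocStencil₂ S₂` with `0 < m`):
`Π̂ᵀ_bond (κ u ↦ vertexOfK G N (S₂ κ u) ν y′) κ u = vertexOfK G N (κ′ u′ ↦ Π̂ᵀ_bond (β w ↦ S₂ β w κ′ u′) κ u) ν y′` — the window is a FINITE sum in
the first bond slot, the vertex an absolutely convergent `ℋ`-column series in the second (an2's `coProjSymAt_tsum` + `AxialDressing.summable_colH_mul_stencil`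
on the re-anchored slices). -/
theorem coProjSymAtK_innerVertex (ρ : Fin (d + 1) → ℤ) {G : MKer (d + 1) (Fib d)} {C δG : ℝ} (hG : Decays G C δG) (hδG : 0 ≤ δG)
    {S₂ : Fin (d + 1) → (Fin (d + 1) → ℤ) → Fin (d + 1) → (Fin (d + 1) → ℤ) → MKer (d + 1) (Fib d)} {C₂ m : ℝ}
    (hS₂ : LocStencil₂ S₂ C₂ m) (hm : 0 < m) (ν : Fin (d + 1)) (y' : Fin (d + 1) → ℤ) (κ : Fin (d + 1)) (u : Fin (d + 1) → ℤ) :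
    coProjSymAtK ρ N (fun κ u => vertexOfK G N (S₂ κ u) ν y') κ u =
      vertexOfK G N (fun κ' u' => coProjSymAtK ρ N (fun β w => S₂ β w κ' u') κ u) ν y' := by
  funext x z a b
  have hsum : ∀ (β : Fin (d + 1)) (w : Fin (d + 1) → ℤ) (κ' : Fin (d + 1)),
      Summable fun u' => colH G N ν y' κ' u' * S₂ β w κ' u' x z a b := fun β w κ' =>
    AxialDressing.summable_colH_mul_stencil hG hδG (locStencil_slice_of_locStencil₂ hS₂ hm.le β w) (half_pos hm) κ' ν y' x z a b
  calc coProjSymAtK ρ N (fun κ u => vertexOfK G N (S₂ κ u) ν y') κ u x z a b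
      = coProjSymAt ρ N (fun β w => ∑ κ' : Fin (d + 1), ∑' u', colH G N ν y' κ' u' * S₂ β w κ' u' x z a b) κ u := rfl
    _ = ∑ κ' : Fin (d + 1), coProjSymAt ρ N (fun β w => ∑' u', colH G N ν y' κ' u' * S₂ β w κ' u' x z a b) κ u :=
        coProjSymAt_finset_sum ρ N Finset.univ (fun κ' β w => ∑' u', colH G N ν y' κ' u' * S₂ β w κ' u' x z a b) κ u
    _ = ∑ κ' : Fin (d + 1), ∑' u', coProjSymAt ρ N (fun β w => colH G N ν y' κ' u' * S₂ β w κ' u' x z a b) κ u :=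
        Finset.sum_congr rfl fun κ' _ =>
          coProjSymAt_tsum ρ N (g := fun u' β w => colH G N ν y' κ' u' * S₂ β w κ' u' x z a b) (fun β w => hsum β w κ') κ u
    _ = ∑ κ' : Fin (d + 1), ∑' u', colH G N ν y' κ' u' * coProjSymAt ρ N (fun β w => S₂ β w κ' u' x z a b) κ u :=
        Finset.sum_congr rfl fun κ' _ => tsum_congr fun u' =>
          coProjSymAt_mul_left' ρ N (colH G N ν y' κ' u') (fun β w => S₂ β w κ' u' x z a b) κ u
    _ = vertexOfK G N (fun κ' u' => coProjSymAtK ρ N (fun β w => S₂ β w κ' u') κ u) ν y' x z a b := rfl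

/-- [folklore] **THE SLOT-1 PROJECTION OF A LOCAL BI-TABLE IS A LOCAL STENCIL FAMILY IN ITS SECOND SLOT** (in-block root, `0 ≤ m`): for each `(κ, u)`,
`κ′ u′ ↦ Π̂ᵀ_bond (β w ↦ S₂ β w κ′ u′) κ u` is `LocStencil` at rate `m/2` with constant `card(cube)·((d+1)·((1+4(d+1)N)·C₂))` (window bound
`abs_pmSymBm_le'` × the re-anchored slice bound `locStencil_slice_of_locStencil₂`). -/
theorem locStencil_slotOneProj (hN : 1 ≤ N) (hr : r ∈ box (d + 1) N)
    {S₂ : Fin (d + 1) → (Fin (d + 1) → ℤ) → Fin (d + 1) → (Fin (d + 1) → ℤ) → MKer (d + 1) (Fib d)} {C₂ m : ℝ}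
    (hS₂ : LocStencil₂ S₂ C₂ m) (hm : 0 ≤ m) (κ : Fin (d + 1)) (u : Fin (d + 1) → ℤ) :
    LocStencil (fun κ' u' => coProjSymAtK (toSite r) N (fun β w => S₂ β w κ' u') κ u)
      (((cube (d + 1) N).card : ℝ) * ((d + 1 : ℕ) * ((1 + 4 * (((d : ℝ) + 1) * N)) * C₂))) (m / 2) := by
  intro κ' u' x z a b
  have hC₂ := hS₂.nonneg
  dsimp only
  rw [coProjSymAtK_eval, coProjSymAt_apply]
  have hE : ∀ (v : Fin (d + 1) → ℤ) (β : Fin (d + 1)),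
      |pmSymBm (toSite r) N β (u + v) κ u * S₂ β (u + v) κ' u' x z a b| ≤
        (1 + 4 * (((d : ℝ) + 1) * N)) * C₂ * Real.exp (-(m / 2) * (l1 (x - u') + l1 (z - u'))) := by
    intro v β
    rw [abs_mul]
    have h1 := abs_pmSymBm_le' hN hr β (u + v) κ u
    have h2 := locStencil_slice_of_locStencil₂ hS₂ hm β (u + v) κ' u' x z a b
    calc |pmSymBm (toSite r) N β (u + v) κ u| * |S₂ β (u + v) κ' u' x z a b|
        ≤ (1 + 4 * (((d : ℝ) + 1) * N)) * (C₂ * Real.exp (-(m / 2) * (l1 (x - u') + l1 (z - u')))) :=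
          mul_le_mul h1 h2 (abs_nonneg _) (by positivity)
      _ = _ := by ring
  calc |∑ v ∈ cube (d + 1) N, ∑ β : Fin (d + 1), pmSymBm (toSite r) N β (u + v) κ u * S₂ β (u + v) κ' u' x z a b|
      ≤ ∑ v ∈ cube (d + 1) N, ∑ β : Fin (d + 1), |pmSymBm (toSite r) N β (u + v) κ u * S₂ β (u + v) κ' u' x z a b| :=
        (Finset.abs_sum_le_sum_abs _ _).trans (Finset.sum_le_sum fun v _ => Finset.abs_sum_le_sum_abs _ _)
    _ ≤ ∑ v ∈ cube (d + 1) N, ∑ β : Fin (d + 1),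
          (1 + 4 * (((d : ℝ) + 1) * N)) * C₂ * Real.exp (-(m / 2) * (l1 (x - u') + l1 (z - u'))) :=
        Finset.sum_le_sum fun v _ => Finset.sum_le_sum fun β _ => hE v β
    _ = ((cube (d + 1) N).card : ℝ) * ((d + 1 : ℕ) * ((1 + 4 * (((d : ℝ) + 1) * N)) * C₂)) *
          Real.exp (-(m / 2) * (l1 (x - u') + l1 (z - u'))) := by
        simp only [Finset.sum_const, Finset.card_univ, Fintype.card_fin, nsmul_eq_mul]
        ring

end Transfer

/-! ## §2 The identity: the dressing of the bi-vertex through the co-dressed leg -/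

section Identity

variable {N : ℕ} {r : Fin (d + 1) → ℕ}

/-- [folklore] **«COPROJ₂-SYM» — THE BLOCK-MEAN DRESSING OF THE BI-VERTEX THROUGH THE CO-DRESSED LEG IS THE BI-VERTEX THROUGH THE UNDRESSED LEG OF THE
TWICE-PROJECTED, DRESSED BI-TABLE** (in-block root `ρ = toSite r`, `Decays K C δ` with `0 < δ`, `LocStencil₂ S₂ C₂ m` with `0 < m`):
`Π̂ (vertex2OfK (Π̂ᵀKΠ̂) N S₂ μ y ν y′) Π̂ᵀ = vertex2OfK K N Ŝ₂ μ y ν y′`, `Ŝ₂ κ u κ′ u′ = Π̂ (Π̂ᵀ_bond (κ″ u″ ↦ Π̂ᵀ_bond (β w ↦ S₂ β w κ″ u″) κ u) κ′ u′) Π̂ᵀ`.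
PROOF: the bi-vertex is the outer vertex of the inner-vertex family (`rfl`); §1's transfer on the outer slot (the inner vertices are a local family,
`locStencil_innerVertex`); the window passes into each inner vertex (`coProjSymAtK_innerVertex`); §1's transfer on each inner slot (`locStencil_slotOneProj`).
The co-dressed leg's decay and the common rate are taken inside (an2's `decays_coDressKSymAt`, `decays_mono`, `LocStencil₂.mono`). -/
theorem dressKSymAt_vertex2OfK_coDress (hN : 1 ≤ N) (hr : r ∈ box (d + 1) N) {K : MKer (d + 1) (Fib d)} {C δ : ℝ}
    (hK : Decays K C δ) (hδ : 0 < δ)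
    {S₂ : Fin (d + 1) → (Fin (d + 1) → ℤ) → Fin (d + 1) → (Fin (d + 1) → ℤ) → MKer (d + 1) (Fib d)} {C₂ m : ℝ}
    (hS₂ : LocStencil₂ S₂ C₂ m) (hm : 0 < m) (μ : Fin (d + 1)) (y : Fin (d + 1) → ℤ) (ν : Fin (d + 1)) (y' : Fin (d + 1) → ℤ) :
    dressKSymAt (toSite r) N (vertex2OfK (coDressKSymAt (toSite r) N K) N S₂ μ y ν y') =
      vertex2OfK K N (fun κ u κ' u' => dressKSymAt (toSite r) N
        (coProjSymAtK (toSite r) N (fun κ'' u'' => coProjSymAtK (toSite r) N (fun β w => S₂ β w κ'' u'') κ u) κ' u')) μ y ν y' := by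
  -- the co-dressed leg decays; common rate for the leg and the bi-table
  obtain ⟨δG, CG, hδG, hCG, hG⟩ := decays_coDressKSymAt hN hr ⟨δ, C, hδ, hK.nonneg (Sum.inl 0), hK⟩
  set m₀ : ℝ := min δG m with hm₀def
  have hm₀ : 0 < m₀ := lt_min hδG hm
  have hG₀ : Decays (coDressKSymAt (toSite r) N K) CG m₀ := decays_mono hG hCG le_rfl (min_le_left _ _)
  have hS₂₀ : LocStencil₂ S₂ C₂ m₀ := hS₂.mono (min_le_right _ _)
  -- the inner vertices form a local family; so do the slot-1 projections
  have hT := locStencil_innerVertex (N := N) hG₀ hCG hS₂₀ hm₀ ν y'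
  have hP₁ := fun κ u => locStencil_slotOneProj hN hr hS₂₀ hm₀.le κ u
  -- the bi-vertex through `G` is the outer vertex of the inner-vertex family
  have eA : vertex2OfK (coDressKSymAt (toSite r) N K) N S₂ μ y ν y' =
      vertexOfK (coDressKSymAt (toSite r) N K) N
        (fun κ u => vertexOfK (coDressKSymAt (toSite r) N K) N (S₂ κ u) ν y') μ y := rfl
  -- outer slot
  rw [eA, ← vertexOfK_dressSym_of_locStencil hN hr hK hδ hT hm₀ μ y]
  -- inner slots
  unfold SecondOrderResponse.vertex2OfK
  congr 1
  funext κ u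
  rw [coProjSymAtK_innerVertex (toSite r) hG₀ hm₀.le hS₂₀ hm₀ ν y' κ u]
  exact (vertexOfK_dressSym_of_locStencil hN hr hK hδ (hP₁ κ u) (half_pos hm₀) ν y').symm

/-- [folklore] **THE SAME FOR A NAMED BI-TABLE** `Ŝ₂` with the displayed pointwise identity (so that a consumer may `def` the twice-projected dressed
bi-table once and cite it). -/
theorem dressKSymAt_vertex2OfK_coDress_congr (hN : 1 ≤ N) (hr : r ∈ box (d + 1) N) {K : MKer (d + 1) (Fib d)} {C δ : ℝ}
    (hK : Decays K C δ) (hδ : 0 < δ)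
    {S₂ Shat : Fin (d + 1) → (Fin (d + 1) → ℤ) → Fin (d + 1) → (Fin (d + 1) → ℤ) → MKer (d + 1) (Fib d)} {C₂ m : ℝ}
    (hS₂ : LocStencil₂ S₂ C₂ m) (hm : 0 < m)
    (hShat : ∀ κ u κ' u', Shat κ u κ' u' = dressKSymAt (toSite r) N
      (coProjSymAtK (toSite r) N (fun κ'' u'' => coProjSymAtK (toSite r) N (fun β w => S₂ β w κ'' u'') κ u) κ' u'))
    (μ : Fin (d + 1)) (y : Fin (d + 1) → ℤ) (ν : Fin (d + 1)) (y' : Fin (d + 1) → ℤ) :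
    dressKSymAt (toSite r) N (vertex2OfK (coDressKSymAt (toSite r) N K) N S₂ μ y ν y') = vertex2OfK K N Shat μ y ν y' := by
  have e : Shat = fun κ u κ' u' => dressKSymAt (toSite r) N
      (coProjSymAtK (toSite r) N (fun κ'' u'' => coProjSymAtK (toSite r) N (fun β w => S₂ β w κ'' u'') κ u) κ' u') :=
    funext fun κ => funext fun u => funext fun κ' => funext fun u' => hShat κ u κ' u'
  rw [e]
  exact dressKSymAt_vertex2OfK_coDress hN hr hK hδ hS₂ hm μ y ν y'

end Identity

/-! ## §3 The symmetric case: the symmetrised bi-vertex of a slot-symmetric bi-table is the bi-vertex -/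

section Symm

variable {N : ℕ} [NeZero N]

/-- [folklore] **FOR A SLOT-SYMMETRIC BOUNDED BI-TABLE THE SWAPPED BI-VERTEX IS THE DIRECT ONE**: `S₂ κ′ u′ κ u = S₂ κ u κ′ u′` ⟹
`vertex2OfK K N S₂ ν y′ μ y = vertex2OfK K N S₂ μ y ν y′` (an1's Fubini `KernelWardSwap.vertex2OfK_swap_eq_transpose` BY NAME). -/
theorem vertex2OfK_swap_of_symm {K : MKer (d + 1) (Fib d)} (hK : ∃ δ C : ℝ, 0 < δ ∧ 0 ≤ C ∧ Decays K C δ)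
    {S₂ : Fin (d + 1) → (Fin (d + 1) → ℤ) → Fin (d + 1) → (Fin (d + 1) → ℤ) → MKer (d + 1) (Fib d)} {B₂ : ℝ}
    (hB₂ : ∀ κ u κ' u' x z a b, |S₂ κ u κ' u' x z a b| ≤ B₂) (hsym : ∀ κ u κ' u', S₂ κ' u' κ u = S₂ κ u κ' u')
    (μ : Fin (d + 1)) (y : Fin (d + 1) → ℤ) (ν : Fin (d + 1)) (y' : Fin (d + 1) → ℤ) :
    vertex2OfK K N S₂ ν y' μ y = vertex2OfK K N S₂ μ y ν y' := by
  rw [vertex2OfK_swap_eq_transpose hK hB₂ μ y ν y']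
  have e : (fun κ' u' κ u => S₂ κ u κ' u') = S₂ :=
    funext fun κ' => funext fun u' => funext fun κ => funext fun u => (hsym κ' u' κ u)
  rw [e]

/-- [folklore] **THE SYMMETRISED BI-VERTEX OF A SLOT-SYMMETRIC BOUNDED BI-TABLE IS THE BI-VERTEX**:
`½ • (vertex2OfK K N S₂ μ y ν y′ + vertex2OfK K N S₂ ν y′ μ y) = vertex2OfK K N S₂ μ y ν y′` (the shape of an2's `W2SymOfK` on its bi-vertex summand). -/
theorem half_sum_vertex2OfK_of_symm {K : MKer (d + 1) (Fib d)} (hK : ∃ δ C : ℝ, 0 < δ ∧ 0 ≤ C ∧ Decays K C δ)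
    {S₂ : Fin (d + 1) → (Fin (d + 1) → ℤ) → Fin (d + 1) → (Fin (d + 1) → ℤ) → MKer (d + 1) (Fib d)} {B₂ : ℝ}
    (hB₂ : ∀ κ u κ' u' x z a b, |S₂ κ u κ' u' x z a b| ≤ B₂) (hsym : ∀ κ u κ' u', S₂ κ' u' κ u = S₂ κ u κ' u')
    (μ : Fin (d + 1)) (y : Fin (d + 1) → ℤ) (ν : Fin (d + 1)) (y' : Fin (d + 1) → ℤ) :
    (1 / 2 : ℝ) • (vertex2OfK K N S₂ μ y ν y' + vertex2OfK K N S₂ ν y' μ y) = vertex2OfK K N S₂ μ y ν y' := by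
  rw [vertex2OfK_swap_of_symm hK hB₂ hsym μ y ν y', ← two_smul ℝ (vertex2OfK K N S₂ μ y ν y'), smul_smul]
  norm_num

/-- [folklore] … with the boundedness read off a `LocStencil₂` letter (`abs_le_of_locStencil₂`). -/
theorem half_sum_vertex2OfK_of_symm_locStencil₂ {K : MKer (d + 1) (Fib d)} (hK : ∃ δ C : ℝ, 0 < δ ∧ 0 ≤ C ∧ Decays K C δ)
    {S₂ : Fin (d + 1) → (Fin (d + 1) → ℤ) → Fin (d + 1) → (Fin (d + 1) → ℤ) → MKer (d + 1) (Fib d)} {C₂ m : ℝ}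
    (hS₂ : LocStencil₂ S₂ C₂ m) (hm : 0 ≤ m) (hsym : ∀ κ u κ' u', S₂ κ' u' κ u = S₂ κ u κ' u')
    (μ : Fin (d + 1)) (y : Fin (d + 1) → ℤ) (ν : Fin (d + 1)) (y' : Fin (d + 1) → ℤ) :
    (1 / 2 : ℝ) • (vertex2OfK K N S₂ μ y ν y' + vertex2OfK K N S₂ ν y' μ y) = vertex2OfK K N S₂ μ y ν y' :=
  half_sum_vertex2OfK_of_symm hK (abs_le_of_locStencil₂ hS₂ hm) hsym μ y ν y'

end Symm

end Summit.QuantumFields.BalabanUV.Beta.FP.BiVertexDressSym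

end
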